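/-
Copyright (c) 2026. All rights reserved.
Released under Apache 2.0 license as described in the file LICENSE.
Authors: HodgeCM publication cell (pub-hodgecm), GR lane, seat GR-2 (`pub-hodgecm-own-hyp34`).
-/
import Literature.NumberTheory.GelbartRogawski1991.Prop311PrintedLineL2Continuity
import Literature.NumberTheory.GelbartRogawski1991.Prop311PrintedLegOfFrame
import Literature.NumberTheory.GelbartRogawski1991.Prop311PrintedDarbouxLegAlong
import Literature.NumberTheory.GelbartRogawski1991.Prop311PrintedCM
import Literature.NumberTheory.Weil1964.AdelicMetaplecticUnitaryLegL2
import HarnessLib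

-- buildfix G11b-3 recipe (LEDGER B13-1/B13-3): elaborate sequentially (dependent telescopes of the CM dual-pair datum).
set_option Elab.async false

/-!
# [GelbartRogawski1991, Prop. 3.1.1] AS PRINTED, at CM data, for the `L²(𝐀ⁿ)` model of `ρ_ψ` — the assembly

Topic `NumberTheory/GelbartRogawski1991`; namespace `Literature.NumberTheory.GelbartRogawski1991.Prop311`.  KERNEL ONLY: one
definition with body (`cmL2Model`, the model) and proved theorems; nothing of [GelbartRogawski1991] or [Weil1964] is
asserted; `Prop311AsPrinted` is untouched (its BODY is proved here, at CM data and one model, under the listed inputs).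

THE MODEL.  `L` a CM field, `F = L⁺`, `E = L`, `σ` = complex conjugation, `ψ = ψ_F` (Tate's character `adeleAddChar`);
`(V, Φ)` skew-Hermitian with a `Φ`-orthogonal basis `b`, `Φ(bᵢ, bᵢ) = fᵢ · δ_L`; `e : Fin n × Fin 1 ≃ Fin n` the line
enumeration; `ν` any Haar measure on `𝐀_Fⁿ`.  `cmL2Model … ν := ρ_{L²} ∘ toCoordHeisenberg e_D` — the `L²(𝐀_Fⁿ, ν)`
Schrödinger representation (`SchrodingerHaar.rep`) read through the Darboux frame `e_D = darbouxFrame b f e`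
(`Prop311PrintedLegOfFrame.toCoordHeisenberg`): a representation of the printed `H_𝐀(W)` on the Hilbert space `L²(𝐀_Fⁿ)`
by isometries (`norm_cmL2Model`).

THE THEOREM **`prop311_CM_L2`**: for this model, "`π` splits uniquely over `Sp_F(W)`" AND clauses (1) ∧ (2) of
Prop. 3.1.1 verbatim — i.e. the binders `(i, _hi, _hi!)` and the conclusion of `Prop311AsPrinted` at `(L⁺, L, conj)` — from:
* `hd` — the classes of `𝒮(𝐀_Fⁿ)` are dense in `L²(ν)` (GR-1 lane, `AdelicSchrodingerL2Dense`; bridge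
  `Weil1964.denseRange_schwartzBruhatToL2_of_dense`);
* `hall` — every operator of `Mp_ψ(W_𝐀)ᶜᵒⁿᵗ` multiplies `‖[·]‖` by a constant (the GR lane's scalar identities
  `∫⁻‖ω(p)Φ‖ₑ² = c_p ∫⁻‖Φ‖ₑ²`, bridge `Weil1964.adelicMpCont.toOp_mem_scaledIsometries_toL2_of_lintegral`; generators suffice,
  `Weil1964.adelicMpCont.toOp_mem_scaledIsometries_of_generators`);
* `hρi` — irreducibility of the model (the binder `_hρi` of `Prop311AsPrinted`; GR-1 lane `AdelicSchrodingerL2Irreducible`);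
* `hrank` — the archimedean coverage of the tree's Levi-form `KAK` implementer sections: at every real place all but one of
  the `σ_v(-2 d fᵢ)` have a common strict sign (`V_v` of real rank `≤ 1`; the line is compact); equivalently
  (`hrank_of_signs`, via `embedding_of_isReal_imagUnitSq_neg : σ_v(δ_L²) < 0`) all but one of the `σ_v(fᵢ)` do.
Chain: `compatibleSplitting_pairLineDatum_CM` (the stage-1 kernel `GRConstruction.gru_shape`: a continuous compatible `s`)
→ `continuous_toL2_omega_relabel_pairLineSplitting` (Weil's Lemme 5 ⇒ `L²`-continuity along `s`) →
`adelicMpCont.unitaryLegL2` (unitary extension) → `legOfFrame` (print's `Mp_𝐀(W)` along the frame) →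
`exists_isRationalSplitting_printed_conclusion_CM_of_darbouxLeg_along` (the along-the-section socket).

## References
* [GelbartRogawski1991] S. Gelbart, J. Rogawski, Invent. Math. 105 (1991) 445–472, §3.1 p. 454 L17–42, Prop. 3.1.1
  p. 455 L1–2.
* [Weil1964] A. Weil, Acta Math. 111 (1964) 143–211, Chap. I n° 11–13, Chap. III n° 37–41.
-/

set_option autoImplicit false

noncomputable section

open NumberField MeasureTheory
open scoped TensorProduct Matrix
open Literature.NumberTheory.Automorphic
open Literature.RepresentationTheory.HeisenbergGroup
open Literature.RepresentationTheory.Unitary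
open Literature.NumberTheory.Weil1964

namespace Literature.NumberTheory.GelbartRogawski1991

namespace Prop311

open UnitaryDualPair

attribute [local instance] secondCountableTopology_adeleRing

section CM

variable (L : Type) [Field L] [NumberField L] [IsCMField L]
variable {n : ℕ} (f : Fin n → ↥(maximalRealSubfield L))
variable (e : Fin n × Fin 1 ≃ Fin n) (he : ∀ k : Fin n, (e.symm k).1 = k)
-- `V` an `L`-space; its `L⁺`-structure is Mathlib's restriction (no separate binder).
variable (V : Type) [AddCommGroup V] [Module L V]
variable (b : Module.Basis (Fin n) L V) (Φ : V →ₗ[↥(maximalRealSubfield L)] V →ₗ[↥(maximalRealSubfield L)] L)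
variable (hΦ₁ : ∀ (a : L) (x y : V), Φ (a • x) y = a * Φ x y)
  (hΦ₂ : ∀ (a : L) (x y : V), Φ x (a • y) = Φ x y * IsCMField.complexConj L a)
  (hb : ∀ i j, i ≠ j → Φ (b i) (b j) = 0)
  (hf : ∀ i, Φ (b i) (b i) = algebraMap (↥(maximalRealSubfield L)) L (f i) * imagUnit L)
  (hφ : (traceForm (↥(maximalRealSubfield L)) L V Φ).Nondegenerate)
/-! ### The rank hypothesis from the signatures `σ_v(fᵢ)` -/

/-- `σ_v(δ_L²) < 0` at every real place of `L⁺`: `δ_L` is purely imaginary under the complex place over `v`.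
[cite: GelbartRogawski1991, §3.1 p. 454 L37–42] -/
theorem embedding_of_isReal_imagUnitSq_neg (v : {v : InfinitePlace ↥(maximalRealSubfield L) // v.IsReal}) :
    InfinitePlace.embedding_of_isReal v.2 (imagUnitSq L) < 0 := by
  have hτ : (InfinitePlace.mk (Weil1964.cmPlaceOver L v).1.embedding).comap
      (algebraMap (↥(maximalRealSubfield L)) L) = v.1 := by
    rw [InfinitePlace.mk_embedding]; exact Weil1964.cmPlaceOver_comap L v
  have h1 := Weil1964.embedding_algebraMap_eq_embedding_of_isReal L v (Weil1964.cmPlaceOver L v).1.embedding hτ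
    (imagUnitSq L)
  have hre := UnitaryGroup.re_embedding_delta (↥(maximalRealSubfield L)) L (IsCMField.complexConj L)
    (Weil1964.cmPlaceOver L v) (Weil1964.cmPlaceOver_smul L v) (IsCMField.complexConj_ne_one L) (complexConj_imagUnit L)
  have him := Weil1964.im_embedding_cmPlaceOver_imagUnit_ne_zero L v
  rw [← imagUnit_mul_self, map_mul] at h1
  have h2 := congrArg Complex.re h1
  rw [Complex.mul_re, hre, zero_mul, zero_sub, Complex.ofReal_re] at h2
  rw [← h2, neg_lt_zero]
  exact mul_self_pos.2 him

/-- the rank hypothesis `hrank` of `prop311_CM_L2` from the signs of the `σ_v(fᵢ)` (`σ_v(-2 δ² fᵢ)` has the sign of `σ_v(fᵢ)`):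
"`V` of real rank `≤ 1` at every real place". [cite: GelbartRogawski1991, §3.1 p. 454 L37–42] -/
theorem hrank_of_signs
    (hsig : ∀ v : {v : InfinitePlace ↥(maximalRealSubfield L) // v.IsReal}, ∃ i₀ : Fin n,
      (∀ i, i ≠ i₀ → 0 < InfinitePlace.embedding_of_isReal v.2 (f i)) ∨
        ∀ i, i ≠ i₀ → InfinitePlace.embedding_of_isReal v.2 (f i) < 0)
    (v : {v : InfinitePlace ↥(maximalRealSubfield L) // v.IsReal}) : ∃ i₀ : Fin n,
      (∀ i, i ≠ i₀ → 0 < InfinitePlace.embedding_of_isReal v.2 (-2 * imagUnitSq L * f i)) ∨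
        ∀ i, i ≠ i₀ → InfinitePlace.embedding_of_isReal v.2 (-2 * imagUnitSq L * f i) < 0 := by
  have hc : 0 < InfinitePlace.embedding_of_isReal v.2 (-2 * imagUnitSq L) := by
    rw [map_mul, map_neg, map_ofNat]
    exact mul_pos_of_neg_of_neg (by norm_num) (embedding_of_isReal_imagUnitSq_neg L v)
  obtain ⟨i₀, h⟩ := hsig v
  refine ⟨i₀, h.imp (fun h i hi => ?_) fun h i hi => ?_⟩
  · rw [map_mul]; exact mul_pos hc (h i hi)
  · rw [map_mul]; exact mul_neg_of_pos_of_neg hc (h i hi)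

/-! ### The `L²` model -/

variable [MeasurableSpace (AdeleRing (𝓞 ↥(maximalRealSubfield L)) ↥(maximalRealSubfield L))]
  [BorelSpace (AdeleRing (𝓞 ↥(maximalRealSubfield L)) ↥(maximalRealSubfield L))]
  (ν : Measure (Fin n → AdeleRing (𝓞 ↥(maximalRealSubfield L)) ↥(maximalRealSubfield L))) [ν.IsAddHaarMeasure]
  (hψc : Continuous (adeleAddChar ↥(maximalRealSubfield L) :
    AdeleRing (𝓞 ↥(maximalRealSubfield L)) ↥(maximalRealSubfield L) → Circle))
  (hβc : ∀ y : Fin n → AdeleRing (𝓞 ↥(maximalRealSubfield L)) ↥(maximalRealSubfield L),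
    Continuous fun u : Fin n → AdeleRing (𝓞 ↥(maximalRealSubfield L)) ↥(maximalRealSubfield L) =>
      adelicForm (↥(maximalRealSubfield L)) (Fin n)
        (1 : Matrix (Fin n) (Fin n) (AdeleRing (𝓞 ↥(maximalRealSubfield L)) ↥(maximalRealSubfield L))) u y)

/-- **THE `L²(𝐀_Fⁿ)` MODEL OF THE PRINTED `ρ_ψ` AT CM DATA IN A FRAME**: the `L²` Schrödinger representation of the coordinate
Heisenberg group read through the Darboux frame `darbouxFrame b f e` — `ρ(h) = ρ_{L²}(toCoordHeisenberg e_D h)`.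
[cite: GelbartRogawski1991, §3.1 p. 454 L17–21; Weil1964, Chap. I n° 11] -/
def cmL2Model : Representation ℂ (AdelicHeisenberg (↥(maximalRealSubfield L)) L V Φ) (Lp ℂ 2 ν) :=
  (SchrodingerHaar.rep (adelicForm (↥(maximalRealSubfield L)) (Fin n)
      (1 : Matrix (Fin n) (Fin n) (AdeleRing (𝓞 ↥(maximalRealSubfield L)) ↥(maximalRealSubfield L))))
      (adeleAddChar ↥(maximalRealSubfield L)) hψc hβc ν).comp
    (toCoordHeisenberg
      (darbouxFrame (↥(maximalRealSubfield L)) L (IsCMField.complexConj L) (complexConj_imagUnit L) (imagUnit_ne_zero L)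
        (imagUnit_mul_self L) V b f e (isUnit_det_cmLineGram_of_nondegenerate L f V b Φ hΦ₁ hΦ₂ hb hf hφ))
      (adelicTraceForm_darbouxFrame (↥(maximalRealSubfield L)) L (IsCMField.complexConj L) (complexConj_imagUnit L)
        (imagUnit_ne_zero L) (imagUnit_mul_self L) V b Φ f e he (isUnit_det_cmLineGram_of_nondegenerate L f V b Φ hΦ₁ hΦ₂ hb hf hφ)
        hΦ₁ hΦ₂ hb hf))

/-- unfolding of the model. [cite: GelbartRogawski1991, §3.1 p. 454 L17–21] -/
theorem cmL2Model_apply (h : AdelicHeisenberg (↥(maximalRealSubfield L)) L V Φ) (g : Lp ℂ 2 ν) :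
    cmL2Model L f e he V b Φ hΦ₁ hΦ₂ hb hf hφ ν hψc hβc h g =
      SchrodingerHaar.rep (adelicForm (↥(maximalRealSubfield L)) (Fin n)
          (1 : Matrix (Fin n) (Fin n) (AdeleRing (𝓞 ↥(maximalRealSubfield L)) ↥(maximalRealSubfield L))))
        (adeleAddChar ↥(maximalRealSubfield L)) hψc hβc ν
        (toCoordHeisenberg
          (darbouxFrame (↥(maximalRealSubfield L)) L (IsCMField.complexConj L) (complexConj_imagUnit L) (imagUnit_ne_zero L)
            (imagUnit_mul_self L) V b f e (isUnit_det_cmLineGram_of_nondegenerate L f V b Φ hΦ₁ hΦ₂ hb hf hφ))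
          (adelicTraceForm_darbouxFrame (↥(maximalRealSubfield L)) L (IsCMField.complexConj L) (complexConj_imagUnit L)
            (imagUnit_ne_zero L) (imagUnit_mul_self L) V b Φ f e he
            (isUnit_det_cmLineGram_of_nondegenerate L f V b Φ hΦ₁ hΦ₂ hb hf hφ) hΦ₁ hΦ₂ hb hf) h) g := rfl

/-- **the model is unitary**: `‖ρ(h) g‖ = ‖g‖` (the binder `_hρu` of `Prop311AsPrinted`, PROVED).
[cite: GelbartRogawski1991, §3.1 p. 454 L19–21] -/
theorem norm_cmL2Model (h : AdelicHeisenberg (↥(maximalRealSubfield L)) L V Φ) (g : Lp ℂ 2 ν) :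
    ‖cmL2Model L f e he V b Φ hΦ₁ hΦ₂ hb hf hφ ν hψc hβc h g‖ = ‖g‖ :=
  SchrodingerHaar.norm_rep_apply _ _ hψc hβc ν _ g

include he in
/-- **[GelbartRogawski1991, Prop. 3.1.1] AS PRINTED AT CM DATA FOR THE `L²(𝐀_Fⁿ)` MODEL.**  `L` a CM field (`F = L⁺`, `E = L`,
`σ` = complex conjugation, `ψ = ψ_F`), `(V, Φ)` skew-Hermitian with a `Φ`-orthogonal basis `b`, `Φ(bᵢ, bᵢ) = fᵢ δ_L`, `φ = Tr Φ`
non-degenerate, `ρ = cmL2Model` on `L²(𝐀_Fⁿ, ν)`.  Inputs: `hd` (density of `𝒮` in `L²`), `hall` (every operator of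
`Mp_ψ(W_𝐀)ᶜᵒⁿᵗ` multiplies `‖[·]‖` by a constant), `hρi` (irreducibility of the model — a binder of `Prop311AsPrinted`),
`hrank` (at every real place all but one of the `σ_v(-2 d fᵢ)` of one strict sign: `V` of real rank `≤ 1` everywhere, the
coverage of the tree's archimedean implementer sections).  Conclusion: THE rational splitting `i` of `π` over `Sp_F(W)`
(exists, unique) and clauses (1) ∧ (2) of Prop. 3.1.1 verbatim — the binders `(i, _hi, _hi!)` AND the body of
`Prop311AsPrinted` at this model.  Chain: `compatibleSplitting_pairLineDatum_CM` (stage-1 kernel, `gru_shape`) →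
`continuous_toL2_omega_relabel_pairLineSplitting` (Weil's Lemme 5) → `adelicMpCont.unitaryLegL2` → `legOfFrame` →
`exists_isRationalSplitting_printed_conclusion_CM_of_darbouxLeg_along`.
[cite: GelbartRogawski1991, §3.1 p. 454 L17–42; Prop. 3.1.1 p. 455 L1–2; Weil1964, Chap. I n° 13, Chap. III n° 37–41] -/
theorem prop311_CM_L2 (hΦ₃ : ∀ x y : V, Φ y x = -IsCMField.complexConj L (Φ x y))
    (hd : DenseRange (schwartzBruhatToL2 (↥(maximalRealSubfield L)) (Fin n) ν))
    (hall : ∀ p : adelicMpCont (↥(maximalRealSubfield L)) (Fin n)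
        (1 : Matrix (Fin n) (Fin n) (AdeleRing (𝓞 ↥(maximalRealSubfield L)) ↥(maximalRealSubfield L))),
      adelicMpCont.toOp (↥(maximalRealSubfield L)) (Fin n)
          (1 : Matrix (Fin n) (Fin n) (AdeleRing (𝓞 ↥(maximalRealSubfield L)) ↥(maximalRealSubfield L))) p ∈
        scaledIsometries (schwartzBruhatToL2 (↥(maximalRealSubfield L)) (Fin n) ν))
    (hρi : ∀ K : Submodule ℂ (Lp ℂ 2 ν), IsClosed (K : Set (Lp ℂ 2 ν)) →
      (∀ (h : AdelicHeisenberg (↥(maximalRealSubfield L)) L V Φ), ∀ g ∈ K,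
        cmL2Model L f e he V b Φ hΦ₁ hΦ₂ hb hf hφ ν hψc hβc h g ∈ K) → K = ⊥ ∨ K = ⊤)
    (hrank : ∀ v : {v : InfinitePlace ↥(maximalRealSubfield L) // v.IsReal}, ∃ i₀ : Fin n,
      (∀ i, i ≠ i₀ → 0 < InfinitePlace.embedding_of_isReal v.2 (-2 * imagUnitSq L * f i)) ∨
        ∀ i, i ≠ i₀ → InfinitePlace.embedding_of_isReal v.2 (-2 * imagUnitSq L * f i) < 0) :
    ∃ i : ratSp (↥(maximalRealSubfield L)) L V Φ →*
        adelicMp (↥(maximalRealSubfield L)) L V Φ (cmL2Model L f e he V b Φ hΦ₁ hΦ₂ hb hf hφ ν hψc hβc),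
      IsRationalSplitting (↥(maximalRealSubfield L)) L V Φ _ i ∧
      (∀ i' : ratSp (↥(maximalRealSubfield L)) L V Φ →*
          adelicMp (↥(maximalRealSubfield L)) L V Φ (cmL2Model L f e he V b Φ hΦ₁ hΦ₂ hb hf hφ ν hψc hβc),
        IsRationalSplitting (↥(maximalRealSubfield L)) L V Φ _ i' → i' = i) ∧
      (∃ s : adelicUnitary (↥(maximalRealSubfield L)) L V Φ →*
            adelicMp (↥(maximalRealSubfield L)) L V Φ (cmL2Model L f e he V b Φ hΦ₁ hΦ₂ hb hf hφ ν hψc hβc),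
          ∀ g : adelicUnitary (↥(maximalRealSubfield L)) L V Φ,
            projEnd (↥(maximalRealSubfield L)) L V Φ _ (s g) =
              ((g : AdelicSpace (↥(maximalRealSubfield L)) V ≃ₗ[AdeleRing (𝓞 ↥(maximalRealSubfield L)) ↥(maximalRealSubfield L)]
                  AdelicSpace (↥(maximalRealSubfield L)) V) :
                AdelicSpace (↥(maximalRealSubfield L)) V →ₗ[AdeleRing (𝓞 ↥(maximalRealSubfield L)) ↥(maximalRealSubfield L)]
                  AdelicSpace (↥(maximalRealSubfield L)) V)) ∧
        ∃ s : adelicUnitary (↥(maximalRealSubfield L)) L V Φ →*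
            adelicMp (↥(maximalRealSubfield L)) L V Φ (cmL2Model L f e he V b Φ hΦ₁ hΦ₂ hb hf hφ ν hψc hβc),
          Continuous s ∧
          (∀ g : adelicUnitary (↥(maximalRealSubfield L)) L V Φ,
            projEnd (↥(maximalRealSubfield L)) L V Φ _ (s g) =
              ((g : AdelicSpace (↥(maximalRealSubfield L)) V ≃ₗ[AdeleRing (𝓞 ↥(maximalRealSubfield L)) ↥(maximalRealSubfield L)]
                  AdelicSpace (↥(maximalRealSubfield L)) V) :
                AdelicSpace (↥(maximalRealSubfield L)) V →ₗ[AdeleRing (𝓞 ↥(maximalRealSubfield L)) ↥(maximalRealSubfield L)]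
                  AdelicSpace (↥(maximalRealSubfield L)) V)) ∧
          ∀ g : adelicUnitary (↥(maximalRealSubfield L)) L V Φ,
            IsRationalPoint (↥(maximalRealSubfield L)) L V Φ
                (g : AdelicSpace (↥(maximalRealSubfield L)) V ≃ₗ[AdeleRing (𝓞 ↥(maximalRealSubfield L)) ↥(maximalRealSubfield L)]
                  AdelicSpace (↥(maximalRealSubfield L)) V) →
              s g ∈ i.range := by
  -- frame data (explicit terms; `have` before `rcases` under the large goal)
  have hT := isUnit_det_cmLineGram_of_nondegenerate L f V b Φ hΦ₁ hΦ₂ hb hf hφ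
  have hf0 : ∀ i, f i ≠ 0 := frame_ne_zero_of_nondegenerate (↥(maximalRealSubfield L)) L (IsCMField.complexConj L) V b Φ f
    hΦ₁ hΦ₂ hb hf hφ
  have hψb := adelicMpCont.continuous_toOp_unitaryLegL2 ν
    (1 : Matrix (Fin n) (Fin n) (AdeleRing (𝓞 ↥(maximalRealSubfield L)) ↥(maximalRealSubfield L))) hψc hβc hd hall
  have hψ := adelicMpCont.proj_unitaryLegL2 ν
    (1 : Matrix (Fin n) (Fin n) (AdeleRing (𝓞 ↥(maximalRealSubfield L)) ↥(maximalRealSubfield L))) hψc hβc hd hall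
  have hGR := compatibleSplitting_pairLineDatum_CM L f e hf0 hT
  rcases hGR with ⟨s, hsc, hs⟩
  -- continuity of the leg along `relabel ∘ s` (symplectic orbit maps: tautological; operators: Weil's Lemme 5 in `L²`)
  have hcont := continuous_legOfFrame_comp
    (darbouxFrame (↥(maximalRealSubfield L)) L (IsCMField.complexConj L) (complexConj_imagUnit L) (imagUnit_ne_zero L)
      (imagUnit_mul_self L) V b f e hT)
    (adelicTraceForm_darbouxFrame (↥(maximalRealSubfield L)) L (IsCMField.complexConj L) (complexConj_imagUnit L)
      (imagUnit_ne_zero L) (imagUnit_mul_self L) V b Φ f e he hT hΦ₁ hΦ₂ hb hf)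
    (cmL2Model L f e he V b Φ hΦ₁ hΦ₂ hb hf hφ ν hψc hβc)
    (SchrodingerHaar.rep (adelicForm (↥(maximalRealSubfield L)) (Fin n)
      (1 : Matrix (Fin n) (Fin n) (AdeleRing (𝓞 ↥(maximalRealSubfield L)) ↥(maximalRealSubfield L))))
      (adeleAddChar ↥(maximalRealSubfield L)) hψc hβc ν)
    (fun _ _ => rfl)
    (adelicMpCont.unitaryLegL2 ν
      (1 : Matrix (Fin n) (Fin n) (AdeleRing (𝓞 ↥(maximalRealSubfield L)) ↥(maximalRealSubfield L))) hψc hβc hd hall) hψb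
    (fun g => adelicMpContRelabel (↥(maximalRealSubfield L)) (Fin n) (legGL (↥(maximalRealSubfield L)) f e hT)
      (one_mul_legGL (↥(maximalRealSubfield L)) f e hT) (s g))
    (fun c => (((adelicMpCont.continuous_proj_apply c).comp
        ((continuous_adelicMpContRelabel (↥(maximalRealSubfield L)) (Fin n) (legGL (↥(maximalRealSubfield L)) f e hT)
          (one_mul_legGL (↥(maximalRealSubfield L)) f e hT)).comp hsc)).congr fun g =>
      congrArg (fun q : symplecticGroup (polar (adelicForm (↥(maximalRealSubfield L)) (Fin n)
          (1 : Matrix (Fin n) (Fin n) (AdeleRing (𝓞 ↥(maximalRealSubfield L)) ↥(maximalRealSubfield L))))) =>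
        ((q : ((Fin n → AdeleRing (𝓞 ↥(maximalRealSubfield L)) ↥(maximalRealSubfield L)) ×
            (Fin n → AdeleRing (𝓞 ↥(maximalRealSubfield L)) ↥(maximalRealSubfield L))) ≃ₗ[
            AdeleRing (𝓞 ↥(maximalRealSubfield L)) ↥(maximalRealSubfield L)]
          ((Fin n → AdeleRing (𝓞 ↥(maximalRealSubfield L)) ↥(maximalRealSubfield L)) ×
            (Fin n → AdeleRing (𝓞 ↥(maximalRealSubfield L)) ↥(maximalRealSubfield L)))) c))
        (hψ _).symm))
    (fun g' => adelicMpCont.continuous_toOp_unitaryLegL2_comp_apply ν _ hψc hβc hd hall _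
      (fun Ψ => continuous_toL2_omega_relabel_pairLineSplitting (↥(maximalRealSubfield L)) L (IsCMField.complexConj L)
        (IsCMField.complexConj_ne_one L) (complexConj_imagUnit L) (imagUnit_ne_zero L) (imagUnit_mul_self L)
        (Weil1964.cmPlaceOver L) (Weil1964.cmPlaceOver_smul L) (Weil1964.cmPlaceOver_comap L) f e he hT ν
        (schwartzBruhatToL2 (↥(maximalRealSubfield L)) (Fin n) ν) (coeFn_schwartzBruhatToL2 ν) hrank hs hsc Ψ) g')
  exact exists_isRationalSplitting_printed_conclusion_CM_of_darbouxLeg_along L f e he V b Φ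
    (cmL2Model L f e he V b Φ hΦ₁ hΦ₂ hb hf hφ ν hψc hβc) hΦ₁ hΦ₂ hΦ₃ hb hf hφ
    (norm_cmL2Model L f e he V b Φ hΦ₁ hΦ₂ hb hf hφ ν hψc hβc) hρi _
    (proj_legOfFrame_frame _ _ _ _ (fun _ _ => rfl) _ hψb hψ) ⟨s, hs, hcont⟩

end CM

end Prop311

end Literature.NumberTheory.GelbartRogawski1991

end
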